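import Summits.BirchSwinnertonDyer.BirchSwinnertonDyer.Theorems.ResidualThetaTransportAtTwoSignedMuVanishingAtTwoPlusAnalyticAtW
import Literature.NumberTheory.EllipticCurves.Zhai2016.NonvanishingQuadraticTwists
import Literature.NumberTheory.EllipticCurves.Zhai2016.NonvanishingQuadraticTwistsErratum
import Literature.NumberTheory.EllipticCurves.BSDQuadraticDescentPeriodEliminationProofs
import HarnessLib

/-!
# Route `ResidualThetaTransportAtTwo`, crux Kμ⁺ `SignedMuVanishingAtTwoPlus` (stmt-BirchSwinnertonDyer-20689):
# the ZHAI DOOR — GRANTED Zhai 2016 Thm. 1.1 (print), the analytic conjunct of Kμ⁺ (child 21437) holds at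
# EVERY inert-prime quadratic twist of an optimal habitat curve with odd `L(E,1)/Ω_E` (an infinite
# print-certified family), with the period unit from Abbes–Ullmo (print) or as a hypothesis

Cell `bsd-wall`, width seat `bsd-wall-rtt-p4-w2` on the lead line `birth` (v4; stub `stub_flatMuZeroAtTwo` = FLAT,
research class-wide; per-class certificate = an odd Néron-normalised plus symbol). THEOREMS ONLY (no `def`, no
named fact, no `sorry`); route-independent helper `--supports` the crux; nothing about any curve is asserted and
BSD is not proved by this. Inputs BY NAME: the tree's named fact `Zhai2016.thm11_ordTwo_LAlg_twist_eq_zero`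
(S. Zhai, Asian J. Math. 20 (2016) Thm. 1.1, PUBLISHED, statement only: for a `Γ₀(C)`-optimal `E` with `Δ_E < 0`,
`E[2](ℚ) = 0` and `ord₂(L(E,1)/Ω_∞(E)) = 0`, and `M ≡ 1 (mod 4)` a square-free product of odd primes inert in the
cubic field of the `2`-division polynomial, prime to `C`: `ord₂(L(E^{(M)},1)/Ω_∞(E^{(M)})) = 0`), the lead's
p567665 `…AnalyticAtW` (`mu_eq_of_isPollackPair_two_of_abbesUllmo_of_norm_LValue_eq_one`: an odd `L(W,1)/Ω_W`
certifies the bookkeeping at `W` granted Abbes–Ullmo; `not_two_dvd_flat_of_norm_LValue_eq_one`), the tree's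
`numRealComponents_baseChange_real`, `quadraticTwist_Δ`, Mathlib `variableChange_Δ`.

The point: the base hypotheses of Zhai's theorem are EXACTLY the habitat's Galois type at `2` (`Δ < 0` and no
rational `2`-torsion: the `2`-division cubic is irreducible with non-square discriminant, image `S₃`) plus the
layer-`0` certificate at the base curve; the conclusion is the layer-`0` certificate at every twist `E^{(M)}`
(`Δ(E^{(M)}) = M⁶ u⁻¹² Δ(E) < 0`, so `Ω_∞ = Ω_{E^{(M)}}` is the full Néron period), i.e. (FLAT) and — granted the
period unit — the analytic conjunct of Kμ⁺ at `E^{(M)}`: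

* `delta_twistModel_neg` — `Δ(WM) < 0` for any model `WM = C • W^{(M)}` of the twist, `M ≠ 0`, `Δ(W) < 0`;
* `leastRealPeriod_eq_realPeriodRat_of_delta_neg` — for `Δ < 0` Zhai's `Ω_∞` is the tree's `Ω(W)` (one real
  component);
* `exists_norm_LValue_eq_one_of_zhai_twist` — GRANTED Zhai Thm. 1.1: `L(WM,1)/Ω(WM) = t` with `|t|₂ = 1`;
* `not_two_dvd_flat_of_zhai_twist_of_periodUnit` — hence (FLAT) `2 ∤ L♭` for every Pollack pair at `2` of the
  newform of `WM`, granted the period unit at `WM`;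
* §3 (appended): the same from the CORRECTED fact `thm11_ordTwo_LAlg_twist_eq_zero'` (arXiv v2 erratum twin: extra binder
  «odd Manin constant»), that binder discharged on the habitat by Abbes–Ullmo (`not_two_dvd_maninConstant_of_abbesUllmo_of_good`).
* **`mu_eq_of_isPollackPair_two_of_zhai_twist_of_abbesUllmo`** — GRANTED Zhai Thm. 1.1 + Abbes–Ullmo Thm. A:
  `μ(G) = m` for every admissible `(G, m)` at `WM` (the conclusion of child 21437 at `WM`), for every such twist
  `WM` good supersingular at `2` with `a₂ = 0` and its newform — TWO print facts, NO per-class datum beyond the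
  base curve's odd `L(E,1)/Ω_E` (Zhai's examples of bases: `19a1`, `X₀(11)`, …; on the habitat: `19a1`).

References: S. Zhai, Asian J. Math. 20 (2016) no. 3, 475–502, Thm. 1.1 [Zhai2016]; A. Abbes, E. Ullmo, Compositio
Math. 103 (1996) Thm. A [AbbesUllmo1996]; F. Sprung, ANT 11 (2017) Cor. 4.4 [Sprung2017]; R. Pollack, Duke Math. J.
118 (2003) Prop. 6.18 [Pollack2003].
-/

set_option autoImplicit false
set_option linter.dupNamespace false

noncomputable section

open scoped Classical MatrixGroups ModularForm

open CongruenceSubgroup WeierstrassCurve Literature.NumberTheory.EllipticCurves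
  Literature.NumberTheory.EllipticCurves.ModularForms Literature.NumberTheory.EllipticCurves.Zhai2016
  Literature.NumberTheory.EllipticCurves.Zhai2021 Literature.NumberTheory.EllipticCurves.CoatesLiTianZhai2015
  Summit.BirchSwinnertonDyer.Rank1Residual.Supersingular Summit.BirchSwinnertonDyer.Rank1Residual.X1

namespace Summit.BirchSwinnertonDyer.BirchSwinnertonDyer.Theorems.SignedMuAtTwo

/-! ## §1. The twist keeps `Δ < 0`; for `Δ < 0` Zhai's `Ω_∞` is the Néron period `Ω(W)` -/

/-- Any model `WM = C • W^{(M)}` of a quadratic twist by `M ≠ 0` of a curve with `Δ(W) < 0` has `Δ(WM) < 0`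
(`Δ(C • X) = u⁻¹² Δ(X)`, `Δ(W^{(M)}) = M⁶ Δ(W)`). [cite: Zhai2016, Thm. 1.1 (setting: negative discriminant)] -/
theorem delta_twistModel_neg {W WM : WeierstrassCurve ℚ} (hΔ : W.Δ < 0) {M : ℤ} (hM : M ≠ 0)
    (hWM : ∃ C : VariableChange ℚ, C • W.quadraticTwist (M : ℚ) = WM) : WM.Δ < 0 := by
  obtain ⟨C, rfl⟩ := hWM
  rw [variableChange_Δ, quadraticTwist_Δ]
  have hu : (0 : ℚ) < (C.u⁻¹ : ℚˣ) ^ 12 := by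
    have : ((C.u⁻¹ : ℚˣ) : ℚ) ≠ 0 := Units.ne_zero _
    positivity
  have hM6 : (0 : ℚ) < (M : ℚ) ^ 6 := by
    have : (M : ℚ) ≠ 0 := by exact_mod_cast hM
    positivity
  exact mul_neg_of_pos_of_neg hu (mul_neg_of_pos_of_neg hM6 hΔ)

/-- For `Δ(W) < 0` the real locus is connected and Zhai's least real period `Ω_∞(W)` (`leastRealPeriod`) IS the
tree's Néron period `Ω(W) = ∫_{E(ℝ)}|ω|` (`realPeriodRat`). [cite: Zhai2016, §2 (chunk p0005 L48)] -/
theorem leastRealPeriod_eq_realPeriodRat_of_delta_neg {W : WeierstrassCurve ℚ} (hΔ : W.Δ < 0) :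
    leastRealPeriod W = W.realPeriodRat := by
  unfold leastRealPeriod
  rw [numRealComponents_baseChange_real, if_neg (not_lt.mpr hΔ.le), Nat.cast_one, div_one]

/-- A non-zero rational with `v₂ = 0` has `2`-adic norm `1`. [folklore] -/
theorem norm_ratCast_eq_one_of_padicValRat_eq_zero {x : ℚ} (hx : x ≠ 0) (hv : padicValRat 2 x = 0) :
    ‖(x : ℚ_[2])‖ = 1 := by
  have hx' : (x : ℚ_[2]) ≠ 0 := by exact_mod_cast hx
  rw [Padic.norm_eq_zpow_neg_valuation hx', Padic.valuation_ratCast, hv, neg_zero, zpow_zero]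

/-! ## §2. GRANTED Zhai 2016 Thm. 1.1: the odd `L`-value, (FLAT), and the analytic conjunct at the twist -/

section Zhai

variable {W : WeierstrassCurve ℚ} [W.IsElliptic] [W.IsGloballyMinimal] [NeZero (W.conductorNorm ℤ)]
  {WM : WeierstrassCurve ℚ} [WM.IsElliptic] [WM.IsGloballyMinimal]

/-- **GRANTED Zhai 2016 Thm. 1.1: an odd `L`-value at the twist, in the tree's currency.** For an optimal datum
`Dt` of `W` (`Λ_W = c Λ_f`), `Δ(W) < 0`, `W(ℚ)[2] = 0`, odd `L(W,1)/Ω_∞(W)`, `F` the cubic field of the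
`2`-division polynomial, `M ≡ 1 (mod 4)` square-free with `≥ 1` prime factors, all odd and inert in `F`,
`(M, N_W) = 1`, and `WM` a globally minimal model of `W^{(M)}`: `L(WM,1)/Ω(WM) = t ∈ ℚ` with `|t|₂ = 1`.
[cite: Zhai2016, Thm. 1.1 (arXiv:1409.0231 chunk p0002 L22–L29)] -/
theorem exists_norm_LValue_eq_one_of_zhai_twist (hZ : thm11_ordTwo_LAlg_twist_eq_zero)
    (Dt : ModularParametrizationData W (W.conductorNorm ℤ)) (hopt : IsOptimalDatum W Dt) (hΔ : W.Δ < 0)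
    (h2 : Nat.card {P : W.toAffine.Point // (2 : ℕ) • P = 0} = 1)
    (hL : ∃ x : ℚ, IsLAlg W x ∧ x ≠ 0 ∧ padicValRat 2 x = 0)
    {F : Type} [Field F] [NumberField F] (hF : IsTwoDivisionField W F)
    {M : ℤ} (hsq : Squarefree M) (hM4 : M % 4 = 1) (hgcd : Int.gcd M (W.conductorNorm ℤ) = 1)
    (hne : M.natAbs.primeFactors.Nonempty) (hin : ∀ q ∈ M.natAbs.primeFactors, q ≠ 2 ∧ IsInertIn F q)
    (hWM : ∃ C : VariableChange ℚ, C • W.quadraticTwist (M : ℚ) = WM) :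
    ∃ t : ℚ, WM.entireLFunction 1 / (WM.realPeriodRat : ℂ) = (t : ℂ) ∧ ‖(t : ℚ_[2])‖ = 1 := by
  obtain ⟨⟨x, hx, hx0, hvx⟩, -, -, -⟩ := hZ W Dt hopt hΔ h2 hL F hF M hsq hM4 hgcd hne hin WM hWM
  have hM0 : M ≠ 0 := by rintro rfl; norm_num at hM4
  have hΔM : WM.Δ < 0 := delta_twistModel_neg hΔ hM0 hWM
  have hΩ : 0 < WM.realPeriodRat := WM.realPeriodRat_pos_holds
  have hΩ' : (WM.realPeriodRat : ℂ) ≠ 0 := by exact_mod_cast hΩ.ne'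
  refine ⟨x, ?_, norm_ratCast_eq_one_of_padicValRat_eq_zero hx0 hvx⟩
  rw [isLAlg_iff, leastRealPeriod_eq_realPeriodRat_of_delta_neg hΔM] at hx
  rw [hx, mul_div_assoc, div_self hΩ', mul_one]

/-- **(FLAT) at a Zhai twist, granted the period unit there**: for `WM` as above, good at `2` with `a₂(WM) = 0`,
its newform `f`, the period ratio `ϖ` and a period unit `Ω(WM) = u Ω⁺_f`, `|u|₂ = 1`: `2 ∤ L♭` for every
Pollack pair at `2` (`L♭(0) = [0]⁺_f`, odd). [cite: Zhai2016, Thm. 1.1] [cite: Sprung2017, Cor. 4.4] -/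
theorem not_two_dvd_flat_of_zhai_twist_of_periodUnit (hZ : thm11_ordTwo_LAlg_twist_eq_zero)
    (Dt : ModularParametrizationData W (W.conductorNorm ℤ)) (hopt : IsOptimalDatum W Dt) (hΔ : W.Δ < 0)
    (h2 : Nat.card {P : W.toAffine.Point // (2 : ℕ) • P = 0} = 1)
    (hL : ∃ x : ℚ, IsLAlg W x ∧ x ≠ 0 ∧ padicValRat 2 x = 0)
    {F : Type} [Field F] [NumberField F] (hF : IsTwoDivisionField W F)
    {M : ℤ} (hsq : Squarefree M) (hM4 : M % 4 = 1) (hgcd : Int.gcd M (W.conductorNorm ℤ) = 1)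
    (hne : M.natAbs.primeFactors.Nonempty) (hin : ∀ q ∈ M.natAbs.primeFactors, q ≠ 2 ∧ IsInertIn F q)
    (hWM : ∃ C : VariableChange ℚ, C • W.quadraticTwist (M : ℚ) = WM)
    (hgood : WM.HasGoodReductionAtPrime 2) (ha : WM.frobeniusTrace 2 = 0)
    {N : ℕ} [NeZero N] {f : CuspForm (Gamma0 N) 2} (hf : IsNewformOf WM f) {ϖ : ℚ}
    (hϖ : (ϖ : ℝ) * WM.realPeriodRat = plusPeriod f)
    (hu : ∃ u : ℚ, ‖(u : ℚ_[2])‖ = 1 ∧ WM.realPeriodRat = u * plusPeriod f)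
    {Lplus Lminus : IwasawaAlgebra 2} (hP : IsPollackPair f 2 Lplus Lminus) :
    ¬ PowerSeries.C (2 : ℤ_[2]) ∣ Lminus := by
  obtain ⟨t, ht, ht1⟩ := exists_norm_LValue_eq_one_of_zhai_twist hZ Dt hopt hΔ h2 hL hF hsq hM4 hgcd hne hin hWM
  exact not_two_dvd_flat_of_norm_LValue_eq_one hf hgood ha hϖ hu hP ht ht1

/-- **GRANTED Zhai 2016 Thm. 1.1 + Abbes–Ullmo Thm. A: the analytic conjunct of Kμ⁺ (child 21437) at every Zhai
twist.** For `WM` a globally minimal model of `W^{(M)}` as above, good supersingular at `2` with `a₂(WM) = 0`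
(habitat), its newform `f`, the period ratio `ϖ` (`ϖ Ω(WM) = Ω⁺_f`) and every Pollack pair `(L♯, L♭)` at `2`:
`μ(G) = m` for every `G ∈ Λ`, `m ≥ 0` with `ι G = 2^m ϖ ι L♭`. Two print facts; the only per-class input is the
BASE curve's odd `L(E,1)/Ω_∞(E)` and optimality. [cite: Zhai2016, Thm. 1.1] [cite: AbbesUllmo1996, Thm. A]
[cite: Pollack2003, Prop. 6.18] -/
theorem mu_eq_of_isPollackPair_two_of_zhai_twist_of_abbesUllmo (hZ : thm11_ordTwo_LAlg_twist_eq_zero)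
    (hAU : abbesUllmo_not_dvd_maninConstant_of_not_dvd_level)
    (Dt : ModularParametrizationData W (W.conductorNorm ℤ)) (hopt : IsOptimalDatum W Dt) (hΔ : W.Δ < 0)
    (h2 : Nat.card {P : W.toAffine.Point // (2 : ℕ) • P = 0} = 1)
    (hL : ∃ x : ℚ, IsLAlg W x ∧ x ≠ 0 ∧ padicValRat 2 x = 0)
    {F : Type} [Field F] [NumberField F] (hF : IsTwoDivisionField W F)
    {M : ℤ} (hsq : Squarefree M) (hM4 : M % 4 = 1) (hgcd : Int.gcd M (W.conductorNorm ℤ) = 1)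
    (hne : M.natAbs.primeFactors.Nonempty) (hin : ∀ q ∈ M.natAbs.primeFactors, q ≠ 2 ∧ IsInertIn F q)
    (hWM : ∃ C : VariableChange ℚ, C • W.quadraticTwist (M : ℚ) = WM)
    (hss : Rank1Residual.GoodSS WM 2) (ha : WM.frobeniusTrace 2 = 0)
    {N : ℕ} [NeZero N] {f : CuspForm (Gamma0 N) 2} (hf : IsNewformOf WM f) {ϖ : ℚ}
    (hϖ : (ϖ : ℝ) * WM.realPeriodRat = plusPeriod f)
    {Lplus Lminus : IwasawaAlgebra 2} (hP : IsPollackPair f 2 Lplus Lminus)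
    (G : IwasawaAlgebra 2) (m : ℕ)
    (hG : iwasawaToPowerSeries 2 G =
      PowerSeries.C ((2 : ℚ_[2]) ^ m * (ϖ : ℚ_[2])) * iwasawaToPowerSeries 2 (kobayashiL 1 Lplus Lminus)) :
    MuLambda.mu G = m := by
  obtain ⟨t, ht, ht1⟩ := exists_norm_LValue_eq_one_of_zhai_twist hZ Dt hopt hΔ h2 hL hF hsq hM4 hgcd hne hin hWM
  exact mu_eq_of_isPollackPair_two_of_abbesUllmo_of_norm_LValue_eq_one hAU hss ha hf hϖ hP ht ht1 G m hG

/-- The same granted the period unit at `WM` as a hypothesis instead of Abbes–Ullmo (e.g. from Cremona's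
`c₀ = 1` for `N ≤ 130000`, this seat's `…CremonaDoor`). [cite: Zhai2016, Thm. 1.1] [cite: Pollack2003, Prop. 6.18] -/
theorem mu_eq_of_isPollackPair_two_of_zhai_twist_of_periodUnit (hZ : thm11_ordTwo_LAlg_twist_eq_zero)
    (Dt : ModularParametrizationData W (W.conductorNorm ℤ)) (hopt : IsOptimalDatum W Dt) (hΔ : W.Δ < 0)
    (h2 : Nat.card {P : W.toAffine.Point // (2 : ℕ) • P = 0} = 1)
    (hL : ∃ x : ℚ, IsLAlg W x ∧ x ≠ 0 ∧ padicValRat 2 x = 0)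
    {F : Type} [Field F] [NumberField F] (hF : IsTwoDivisionField W F)
    {M : ℤ} (hsq : Squarefree M) (hM4 : M % 4 = 1) (hgcd : Int.gcd M (W.conductorNorm ℤ) = 1)
    (hne : M.natAbs.primeFactors.Nonempty) (hin : ∀ q ∈ M.natAbs.primeFactors, q ≠ 2 ∧ IsInertIn F q)
    (hWM : ∃ C : VariableChange ℚ, C • W.quadraticTwist (M : ℚ) = WM)
    (hgood : WM.HasGoodReductionAtPrime 2) (ha : WM.frobeniusTrace 2 = 0)
    {N : ℕ} [NeZero N] {f : CuspForm (Gamma0 N) 2} (hf : IsNewformOf WM f) {ϖ : ℚ}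
    (hϖ : (ϖ : ℝ) * WM.realPeriodRat = plusPeriod f)
    (hu : ∃ u : ℚ, ‖(u : ℚ_[2])‖ = 1 ∧ WM.realPeriodRat = u * plusPeriod f)
    {Lplus Lminus : IwasawaAlgebra 2} (hP : IsPollackPair f 2 Lplus Lminus)
    (G : IwasawaAlgebra 2) (m : ℕ)
    (hG : iwasawaToPowerSeries 2 G =
      PowerSeries.C ((2 : ℚ_[2]) ^ m * (ϖ : ℚ_[2])) * iwasawaToPowerSeries 2 (kobayashiL 1 Lplus Lminus)) :
    MuLambda.mu G = m :=
  mu_eq_of_isPollackPair_two_of_periodUnit_of_not_two_dvd hϖ hu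
    (not_two_dvd_flat_of_zhai_twist_of_periodUnit hZ Dt hopt hΔ h2 hL hF hsq hM4 hgcd hne hin hWM hgood ha hf
      hϖ hu hP) G m hG

end Zhai

/-! ## §3. The same from the CORRECTED fact (arXiv v2: «odd Manin constant»), the extra binder
discharged by Abbes–Ullmo on the habitat -/

section ZhaiCorrected

variable {W : WeierstrassCurve ℚ} [W.IsElliptic] [W.IsGloballyMinimal] [NeZero (W.conductorNorm ℤ)]
  {WM : WeierstrassCurve ℚ} [WM.IsElliptic] [WM.IsGloballyMinimal]

/-- **GRANTED the CORRECTED Zhai 2016 Thm. 1.1** (`thm11_ordTwo_LAlg_twist_eq_zero'`, the erratum twin with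
the binder "odd Manin constant `¬ 2 ∣ c`", file `Zhai2016/NonvanishingQuadraticTwistsErratum`): an odd
`L`-value at the twist, `L(WM,1)/Ω(WM) = t`, `|t|₂ = 1`, the oddness of the base curve's Manin constant kept
as a hypothesis. [cite: Zhai2016, Thm. 1.1 (arXiv:1409.0231v2)] -/
theorem exists_norm_LValue_eq_one_of_zhai_twist' (hZ : thm11_ordTwo_LAlg_twist_eq_zero')
    (Dt : ModularParametrizationData W (W.conductorNorm ℤ)) (hopt : IsOptimalDatum W Dt) (hc : ¬ (2 : ℤ) ∣ Dt.c)
    (hΔ : W.Δ < 0) (h2 : Nat.card {P : W.toAffine.Point // (2 : ℕ) • P = 0} = 1)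
    (hL : ∃ x : ℚ, IsLAlg W x ∧ x ≠ 0 ∧ padicValRat 2 x = 0)
    {F : Type} [Field F] [NumberField F] (hF : IsTwoDivisionField W F)
    {M : ℤ} (hsq : Squarefree M) (hM4 : M % 4 = 1) (hgcd : Int.gcd M (W.conductorNorm ℤ) = 1)
    (hne : M.natAbs.primeFactors.Nonempty) (hin : ∀ q ∈ M.natAbs.primeFactors, q ≠ 2 ∧ IsInertIn F q)
    (hWM : ∃ C : VariableChange ℚ, C • W.quadraticTwist (M : ℚ) = WM) :
    ∃ t : ℚ, WM.entireLFunction 1 / (WM.realPeriodRat : ℂ) = (t : ℂ) ∧ ‖(t : ℚ_[2])‖ = 1 := by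
  obtain ⟨⟨x, hx, hx0, hvx⟩, -, -, -⟩ := hZ W Dt hopt hc hΔ h2 hL F hF M hsq hM4 hgcd hne hin WM hWM
  have hM0 : M ≠ 0 := by rintro rfl; norm_num at hM4
  have hΔM : WM.Δ < 0 := delta_twistModel_neg hΔ hM0 hWM
  have hΩ : 0 < WM.realPeriodRat := WM.realPeriodRat_pos_holds
  have hΩ' : (WM.realPeriodRat : ℂ) ≠ 0 := by exact_mod_cast hΩ.ne'
  refine ⟨x, ?_, norm_ratCast_eq_one_of_padicValRat_eq_zero hx0 hvx⟩
  rw [isLAlg_iff, leastRealPeriod_eq_realPeriodRat_of_delta_neg hΔM] at hx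
  rw [hx, mul_div_assoc, div_self hΩ', mul_one]

/-- **On the habitat the erratum binder is Abbes–Ullmo**: for a base curve `W` with good reduction at `2` the
level `N_W` is odd (`not_dvd_level_of_hasGoodReductionAtPrime`), so the Manin constant of its optimal datum
is odd by `abbesUllmo_not_dvd_maninConstant_of_not_dvd_level`. [cite: AbbesUllmo1996, Thm. A] -/
theorem not_two_dvd_maninConstant_of_abbesUllmo_of_good
    (hAU : abbesUllmo_not_dvd_maninConstant_of_not_dvd_level) (hgood : W.HasGoodReductionAtPrime 2)
    (Dt : ModularParametrizationData W (W.conductorNorm ℤ)) (hopt : IsOptimalDatum W Dt) :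
    ¬ (2 : ℤ) ∣ Dt.c :=
  hAU W Dt hopt 2 Nat.prime_two
    (Literature.NumberTheory.EllipticCurves.SkinnerUrban2014.not_dvd_level_of_hasGoodReductionAtPrime hgood
      Dt.isNewformOf)

/-- **GRANTED the CORRECTED Zhai 2016 Thm. 1.1 + Abbes–Ullmo Thm. A: the analytic conjunct of Kμ⁺ (child 21437)
at every Zhai twist of a base curve good at `2`** — Abbes–Ullmo is used TWICE: for the base curve's odd Manin
constant (the erratum binder) and for the period unit at the twist. [cite: Zhai2016, Thm. 1.1 (arXiv v2)]
[cite: AbbesUllmo1996, Thm. A] [cite: Pollack2003, Prop. 6.18] -/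
theorem mu_eq_of_isPollackPair_two_of_zhai_twist'_of_abbesUllmo (hZ : thm11_ordTwo_LAlg_twist_eq_zero')
    (hAU : abbesUllmo_not_dvd_maninConstant_of_not_dvd_level) (hgoodW : W.HasGoodReductionAtPrime 2)
    (Dt : ModularParametrizationData W (W.conductorNorm ℤ)) (hopt : IsOptimalDatum W Dt) (hΔ : W.Δ < 0)
    (h2 : Nat.card {P : W.toAffine.Point // (2 : ℕ) • P = 0} = 1)
    (hL : ∃ x : ℚ, IsLAlg W x ∧ x ≠ 0 ∧ padicValRat 2 x = 0)
    {F : Type} [Field F] [NumberField F] (hF : IsTwoDivisionField W F)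
    {M : ℤ} (hsq : Squarefree M) (hM4 : M % 4 = 1) (hgcd : Int.gcd M (W.conductorNorm ℤ) = 1)
    (hne : M.natAbs.primeFactors.Nonempty) (hin : ∀ q ∈ M.natAbs.primeFactors, q ≠ 2 ∧ IsInertIn F q)
    (hWM : ∃ C : VariableChange ℚ, C • W.quadraticTwist (M : ℚ) = WM)
    (hss : Rank1Residual.GoodSS WM 2) (ha : WM.frobeniusTrace 2 = 0)
    {N : ℕ} [NeZero N] {f : CuspForm (Gamma0 N) 2} (hf : IsNewformOf WM f) {ϖ : ℚ}
    (hϖ : (ϖ : ℝ) * WM.realPeriodRat = plusPeriod f)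
    {Lplus Lminus : IwasawaAlgebra 2} (hP : IsPollackPair f 2 Lplus Lminus)
    (G : IwasawaAlgebra 2) (m : ℕ)
    (hG : iwasawaToPowerSeries 2 G =
      PowerSeries.C ((2 : ℚ_[2]) ^ m * (ϖ : ℚ_[2])) * iwasawaToPowerSeries 2 (kobayashiL 1 Lplus Lminus)) :
    MuLambda.mu G = m := by
  obtain ⟨t, ht, ht1⟩ := exists_norm_LValue_eq_one_of_zhai_twist' hZ Dt hopt
    (not_two_dvd_maninConstant_of_abbesUllmo_of_good hAU hgoodW Dt hopt) hΔ h2 hL hF hsq hM4 hgcd hne hin hWM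
  exact mu_eq_of_isPollackPair_two_of_abbesUllmo_of_norm_LValue_eq_one hAU hss ha hf hϖ hP ht ht1 G m hG

/-- The v1 fact implies the corrected one (the erratum only WEAKENS), so §2 is the stronger-hypothesis form of
§3 (`thm11_ordTwo_LAlg_twist_eq_zero'_of_v1`). [cite: Zhai2016, Thm. 1.1] -/
theorem mu_eq_of_isPollackPair_two_of_zhai_twist_of_abbesUllmo_of_good (hZ : thm11_ordTwo_LAlg_twist_eq_zero)
    (hAU : abbesUllmo_not_dvd_maninConstant_of_not_dvd_level) (hgoodW : W.HasGoodReductionAtPrime 2)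
    (Dt : ModularParametrizationData W (W.conductorNorm ℤ)) (hopt : IsOptimalDatum W Dt) (hΔ : W.Δ < 0)
    (h2 : Nat.card {P : W.toAffine.Point // (2 : ℕ) • P = 0} = 1)
    (hL : ∃ x : ℚ, IsLAlg W x ∧ x ≠ 0 ∧ padicValRat 2 x = 0)
    {F : Type} [Field F] [NumberField F] (hF : IsTwoDivisionField W F)
    {M : ℤ} (hsq : Squarefree M) (hM4 : M % 4 = 1) (hgcd : Int.gcd M (W.conductorNorm ℤ) = 1)
    (hne : M.natAbs.primeFactors.Nonempty) (hin : ∀ q ∈ M.natAbs.primeFactors, q ≠ 2 ∧ IsInertIn F q)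
    (hWM : ∃ C : VariableChange ℚ, C • W.quadraticTwist (M : ℚ) = WM)
    (hss : Rank1Residual.GoodSS WM 2) (ha : WM.frobeniusTrace 2 = 0)
    {N : ℕ} [NeZero N] {f : CuspForm (Gamma0 N) 2} (hf : IsNewformOf WM f) {ϖ : ℚ}
    (hϖ : (ϖ : ℝ) * WM.realPeriodRat = plusPeriod f)
    {Lplus Lminus : IwasawaAlgebra 2} (hP : IsPollackPair f 2 Lplus Lminus)
    (G : IwasawaAlgebra 2) (m : ℕ)
    (hG : iwasawaToPowerSeries 2 G =
      PowerSeries.C ((2 : ℚ_[2]) ^ m * (ϖ : ℚ_[2])) * iwasawaToPowerSeries 2 (kobayashiL 1 Lplus Lminus)) :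
    MuLambda.mu G = m :=
  mu_eq_of_isPollackPair_two_of_zhai_twist'_of_abbesUllmo (thm11_ordTwo_LAlg_twist_eq_zero'_of_v1 hZ) hAU hgoodW
    Dt hopt hΔ h2 hL hF hsq hM4 hgcd hne hin hWM hss ha hf hϖ hP G m hG

end ZhaiCorrected

end Summit.BirchSwinnertonDyer.BirchSwinnertonDyer.Theorems.SignedMuAtTwo

end
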